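/-
Copyright (c) 2026 the pub-hodgecm-mathlib formalisation cell (harness21).  Prover seat hodgecm-mathlib-LH4-p01 (g6); (C5)′ LARGE census point (3′) (dealer LH4-plan (g7)
WORD #39, 2026-09-02): the (2′)(3′)-half of Flicker's Prop. 13 for `m > N` in the letters of ★ p851968 (C3b) `UnitaryThreeBorelConjugateCongruencesJZeroTrace` (LH4-p02 (g8)).
-/
import Literature.NumberTheory.Automorphic.UnitaryThreeBorelConjugateCongruencesJZeroTrace
import HarnessLib

/-!
# Flicker's Prop. 13 in the TRACE frame: the second and third congruences follow from the fourth (`j = 0`, `m > N`)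

Topic `NumberTheory/Automorphic`; namespace `Literature.NumberTheory.Automorphic.UnitaryGroup`; THEOREMS ONLY (no definition, no instance, no notation, no
`sorry`; kernel lane).  Twin of the «(2)(3)-half of the regimes (b)–(e)» of ★ `UnitaryThreeBorelConjugateCongruencesJZero` (`v_mul_add_le`,
`two_congruences_of_v_mul_le`), which ★ (C3b) `…CongruencesJZeroTrace` does not carry (its §3 heads twin the fourth condition only).

THE MATHEMATICS [Flicker1998UnitaryFL, Prop. 13 pp. 91–93].  In the `(ν, w)` normal form of ★ (C3a) `borel_conj_mem_unitaryInt_iff_of_rel_normForm` the conditions for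
`p⁻¹ τ p ∈ H^K_m` at a `j = 0` torus element `τ = !![A,0,B₁; 0,b,0; B₂,0,D]` are `|νB₂| ≤ 1`, (2′) `|A − b + νB₂σw| ≤ |t|`, (3′) `|D − b + νB₂w| ≤ |t|` and (4′).  With the
`j = 0` letters of ★ (C3b) — `B₂G = (D − b − κB₂)s`, `A − D = (σκ − κ)B₂`, `r(κ + σκ) = b₀G + σb₀σG`, `w + σw = s`, `b₀ + σb₀ = 1`, `X := κν⁻¹ + w + r` — one has the EXACT identities
`D − b + νB₂w = νB₂·X + B₂·E`, `A − b + νB₂σw = νB₂·σX + B₂·E`, `E := G∕s − νr = (νr(X + σX) − 2νC + σb₀(G − σG))∕s`, `C := r(s + r)`;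
so `|X|, |C|, |G − σG| ≤ |ϖ^{m−N}|` (with `|B₂| = |ϖ^N|`, `N ≤ m`, `|ν| = |s| = 1`, `|r|, |b₀| ≤ 1`) give (2′) and (3′) — no `|2| = 1` (the `2` only multiplies).  In the two
value-bearing regimes of the half `m > N` these three bounds hold ((R-bd): `|X| ≤ |ϖ^{m−[N∕2]}|`; (R-ce): `|X| = |ϖ^{(M−N)∕2}|`, `M ≥ 2m − N`), which is how ★'s
`conditions_iff_v_le_of_bounded` ∕ `conditions_iff_norm_sub_le_of_near` are re-assembled by the trace twins of ★ `UnitOrbitalIntegralInertCountJZeroLarge`.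
HONEST LABEL: HC_CM is proved only modulo the printed citations until rung 0 closes; this file is valuation algebra and proves no letter (count-neutral).

## References
* [Flicker1998UnitaryFL] Y. Z. Flicker, *Elementary proof of the fundamental lemma for a unitary group*, Canad. J. Math. 50 (1998): Prop. 13 pp. 91–93.
-/

set_option autoImplicit false

open scoped WithZero

namespace Literature.NumberTheory.Automorphic

namespace UnitaryGroup

open Literature.NumberTheory.Automorphic.HermitianLattice (UnramifiedLocalConjDatum)

variable {K : Type*} [Field K] [Valued K ℤᵐ⁰] {ϖ : K} (σ : K →+* K)

/-! ## §1 The exact identities (pure field algebra; primed letters stand for the `σ`-conjugates) -/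

omit [Valued K ℤᵐ⁰] in
/-- **(3′) in `X`**: `D − b + νB₂w = νB₂·X + B₂·(G∕s − νr)` for `X = κν⁻¹ + w + r`, `B₂G = (D − b − κB₂)s`. [cite: Flicker1998UnitaryFL, Prop. 13 p. 92] -/
theorem condition_three_eq_of_jzero_trace {D b B₂ ν w κ s G r X : K} (hs : s ≠ 0) (hν : ν ≠ 0)
    (hG : B₂ * G = (D - b - κ * B₂) * s) (hX : X = κ * ν⁻¹ + w + r) :
    D - b + ν * B₂ * w = ν * B₂ * X + B₂ * (G / s - ν * r) := by
  have hD : D - b = κ * B₂ + B₂ * G / s := by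
    field_simp
    linear_combination (-1 : K) * hG
  rw [hD, hX]
  field_simp
  ring

omit [Valued K ℤᵐ⁰] in
/-- **(2′) in `X′`**: `A − b + νB₂w′ = νB₂·X′ + B₂·(G∕s − νr)` for `X′ = κ′ν⁻¹ + w′ + r`, `A − D = (κ′ − κ)B₂`, `B₂G = (D − b − κB₂)s` (`w′ = σw`, `κ′ = σκ`, `X′ = σX`).
[cite: Flicker1998UnitaryFL, Prop. 13 p. 92] -/
theorem condition_two_eq_of_jzero_trace {A D b B₂ ν w' κ κ' s G r X' : K} (hs : s ≠ 0) (hν : ν ≠ 0)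
    (hG : B₂ * G = (D - b - κ * B₂) * s) (hAD : A - D = (κ' - κ) * B₂) (hX' : X' = κ' * ν⁻¹ + w' + r) :
    A - b + ν * B₂ * w' = ν * B₂ * X' + B₂ * (G / s - ν * r) := by
  have hA : A - b = κ' * B₂ + B₂ * G / s := by
    field_simp
    linear_combination s * hAD - hG
  rw [hA, hX']
  field_simp
  ring

omit [Valued K ℤᵐ⁰] in
/-- **The constant `G∕s − νr` through small quantities**: `G∕s − νr = (νr(X + X′) − 2ν·r(s + r) + b₀′(G − G′))∕s` when `X + X′ = (κ + κ′)ν⁻¹ + s + 2r`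
(`w + w′ = s`), `r(κ + κ′) = b₀G + b₀′G′`, `b₀ + b₀′ = 1`. [cite: Flicker1998UnitaryFL, Prop. 13 p. 92] -/
theorem sub_eq_of_jzero_trace {ν w w' κ κ' s G G' r b₀ b₀' X X' : K} (hs : s ≠ 0) (hν : ν ≠ 0)
    (hX : X = κ * ν⁻¹ + w + r) (hX' : X' = κ' * ν⁻¹ + w' + r) (hws : w + w' = s) (hb₀ : b₀ + b₀' = 1)
    (hr : r * (κ + κ') = b₀ * G + b₀' * G') :
    G / s - ν * r = (ν * r * (X + X') - 2 * ν * (r * (s + r)) + b₀' * (G - G')) / s := by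
  rw [div_sub' hs, hX, hX']
  congr 1
  have hw' : w' = s - w := by linear_combination hws
  rw [hw']
  field_simp
  linear_combination (-1 : K) * hr - G * hb₀

/-! ## §2 (2′) and (3′) from the smallness of `X`, `C = r(s + r)` and `Δ = G − σG` (`|B₂| = |ϖ^N|`, `N ≤ m`) -/

/-- `|2| ≤ 1` in any valued field (ultrametric inequality on `1 + 1`). [folklore] -/
private theorem v_two_le_one : Valued.v (2 : K) ≤ 1 := by
  rw [show (2 : K) = 1 + 1 by norm_num]
  exact le_trans (Valuation.map_add _ _ _) (by rw [map_one, max_self])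

/-- **(2′) ∧ (3′) FROM `|X|, |r(s+r)|, |G − σG| ≤ |ϖ^{m−N}|`** (`j = 0` letters of ★ (C3b), `|B₂| = |ϖ^N|`, `N ≤ m`, `ν` a `σ`-fixed unit, `|s| = 1`, `|r|, |b₀| ≤ 1`): the (2)(3)-half
of Flicker's regimes (b)–(e) at every residue characteristic (twin of ★ `v_mul_add_le` + `two_congruences_of_v_mul_le`). [cite: Flicker1998UnitaryFL, Prop. 13 pp. 91–93] -/
theorem conditions_two_three_of_v_le_jzero_trace (hd : UnramifiedLocalConjDatum σ ϖ) {A D b B₂ ν w s κ b₀ G r : K} {m N : ℕ}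
    (hν : Valued.v ν = 1) (hσν : σ ν = ν) (hvs : Valued.v s = 1) (hws : w + σ w = s) (htr : κ + σ κ ≠ 0) (hrv : Valued.v r ≤ 1)
    (hb₀ : b₀ + σ b₀ = 1) (hb₀v : Valued.v b₀ ≤ 1) (hB : Valued.v B₂ = Valued.v (ϖ ^ N)) (hNm : N ≤ m)
    (hG : B₂ * G = (D - b - κ * B₂) * s) (hAD : A - D = (σ κ - κ) * B₂) (hr : r * (κ + σ κ) = b₀ * G + σ b₀ * σ G)
    (hX : Valued.v (κ * ν⁻¹ + w + r) ≤ Valued.v (ϖ ^ (m - N))) (hC : Valued.v (r * (s + r)) ≤ Valued.v (ϖ ^ (m - N)))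
    (hΔ : Valued.v (G - σ G) ≤ Valued.v (ϖ ^ (m - N))) :
    Valued.v (A - b + ν * B₂ * σ w) ≤ Valued.v (ϖ ^ m) ∧ Valued.v (D - b + ν * B₂ * w) ≤ Valued.v (ϖ ^ m) := by
  have hs0 : s ≠ 0 := fun h => by rw [h, map_zero] at hvs; exact zero_ne_one hvs
  have hν0 : ν ≠ 0 := fun h => by rw [h, map_zero] at hν; exact zero_ne_one hν
  have hσr : σ r = r := map_eq_self_of_mul_trace_eq σ hd.σσ htr hr
  set X : K := κ * ν⁻¹ + w + r with hXdef
  have hσX : σ X = σ κ * ν⁻¹ + σ w + r := by rw [hXdef]; exact map_mul_inv_add_add σ hσν hσr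
  set E : K := G / s - ν * r with hEdef
  -- the three identities
  have e3 : D - b + ν * B₂ * w = ν * B₂ * X + B₂ * E := condition_three_eq_of_jzero_trace hs0 hν0 hG hXdef
  have e2 : A - b + ν * B₂ * σ w = ν * B₂ * σ X + B₂ * E := condition_two_eq_of_jzero_trace hs0 hν0 hG hAD hσX
  have eE : E = (ν * r * (X + σ X) - 2 * ν * (r * (s + r)) + σ b₀ * (G - σ G)) / s :=
    sub_eq_of_jzero_trace hs0 hν0 hXdef hσX hws hb₀ hr
  -- the bound on `E`
  have vσX : Valued.v (σ X) ≤ Valued.v (ϖ ^ (m - N)) := by rw [hd.vσ]; exact hX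
  have vE : Valued.v E ≤ Valued.v (ϖ ^ (m - N)) := by
    rw [eE, map_div₀, hvs, div_one]
    refine le_trans (Valuation.map_add _ _ _) (max_le (le_trans (Valuation.map_sub _ _ _) (max_le ?_ ?_)) ?_)
    · rw [map_mul, map_mul, hν, one_mul]
      exact le_trans (mul_le_mul' hrv (le_trans (Valuation.map_add _ _ _) (max_le hX vσX))) (by rw [one_mul])
    · rw [map_mul, map_mul, hν, mul_one]
      exact le_trans (mul_le_mul' v_two_le_one hC) (by rw [one_mul])
    · rw [map_mul, hd.vσ]
      exact le_trans (mul_le_mul' hb₀v hΔ) (by rw [one_mul])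
  -- `|B₂|·|ϖ^{m−N}| = |ϖ^m|`
  have hBρ : Valued.v B₂ * Valued.v (ϖ ^ (m - N)) = Valued.v (ϖ ^ m) := by
    rw [hB, ← map_mul, ← pow_add, show N + (m - N) = m by omega]
  have bound : ∀ Y : K, Valued.v Y ≤ Valued.v (ϖ ^ (m - N)) → Valued.v (ν * B₂ * Y + B₂ * E) ≤ Valued.v (ϖ ^ m) := by
    intro Y hY
    refine le_trans (Valuation.map_add _ _ _) (max_le ?_ ?_)
    · rw [map_mul, map_mul, hν, one_mul, ← hBρ]; exact mul_le_mul' le_rfl hY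
    · rw [map_mul, ← hBρ]; exact mul_le_mul' le_rfl vE
  exact ⟨by rw [e2]; exact bound _ vσX, by rw [e3]; exact bound _ hX⟩

end UnitaryGroup

end Literature.NumberTheory.Automorphic
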